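import Mathlib
import Literature.Computability.MetaComplexity.FpLinearSystems
import Literature.Computability.MetaComplexity.ScopeExpansion
import HarnessLib
import Summits.PneNP.PneNP.Theorems.ExpanderLinearGeneratorsFreeCayleyLocal

/-!
# PneNP / ExpanderLinearGenerators — the Tseitin system of a Cayley graph: `16`-sparse,
unsolvable, boundary-expanding (stmt-PneNP-11443, helper file 3 of the non-vacuity construction)

Route `PneNP/ExpanderLinearGenerators`, support item stmt-PneNP-11443
(`LinearGeneratorDepthFregeHard`). Given a finite group `Γ` with eight marked elements `g_k`
(letters `σ = (k, ±)`, `g (k,-) = (g (k,+))⁻¹`), we build a system of linear equations over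
`𝔽₂` in `n ≥ 8|Γ|` variables — the TSEITIN SYSTEM of the left Cayley graph: one variable
`x(y,k)` (numbered `8·idx(y) + k`) per edge `{y, g_k y}`, one equation per group element `x`
saying that the `16` edge variables at `x` sum to `[x = 1]` — and prove, assuming no reduced
relation of length `≤ 2R` (`R ≥ 1`) among the `g_k`:

* `card_supp_tseitin_le` — every equation has `≤ 16` variables (`card_scopeNat`: exactly `16`);
* `not_systemSat_tseitin` — the system is unsolvable (every variable lies in exactly two
  equations, `card_rows_eq_two`, so the equations sum to `0 = 1`);
* `isBoundaryExpander_tseitin` — for every `r ≤ 2^R` the supports form an `(r, 12)`-boundary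
  expander, `12 = 3/4 · 16`: a row set `F` has `16|F| = |∂F| + 2·#(doubly covered points)` and
  the doubly covered points inject into the Cayley edges spanned by `F`, at most `2|F|` of them
  by `edgeCount_le_two_mul_card` (helper file 2).

Reference: G. A. Margulis, *Explicit constructions of graphs without short cycles and low
density codes*, Combinatorica 2 (1982) 71–78; G. S. Tseitin, *On the complexity of derivation
in propositional calculus* (1968) (the graph equations).
-/

namespace Summit.PneNP.PneNP.Theorems

set_option linter.dupNamespace false -- `Summit.PneNP.PneNP.…`: summit = sub-problem (D-0017)

namespace FreeCayley

open Finset Literature.Computability.MetaComplexity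

variable {Γ : Type*} [Fintype Γ]

/-! ### Numbering the edge variables -/

/-- A fixed numbering of the group elements. [folklore] -/
noncomputable def idx : Γ ≃ Fin (Fintype.card Γ) := Fintype.equivFin Γ

/-- The number of the edge variable `x(y, k)` (edge `{y, g_k y}`): `8 · idx y + k`. [folklore] -/
noncomputable def varNat (y : Γ) (k : Fin 8) : ℕ := 8 * (idx y : ℕ) + k

/-- Edge variables are numbered below `8|Γ|`. [folklore] -/
theorem varNat_lt (y : Γ) (k : Fin 8) : varNat y k < 8 * Fintype.card Γ := by
  unfold varNat
  have h1 := (idx y).isLt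
  have h2 := k.isLt
  omega

/-- The numbering of edge variables is injective. [folklore] -/
theorem varNat_inj {y y' : Γ} {k k' : Fin 8} (h : varNat y k = varNat y' k') : y = y' ∧ k = k' := by
  unfold varNat at h
  have hk := k.isLt
  have hk' := k'.isLt
  have h1 : (idx y : ℕ) = idx y' := by omega
  have h2 : (k : ℕ) = k' := by omega
  exact ⟨idx.injective (Fin.ext h1), Fin.ext h2⟩

/-- Decoding a variable number into its edge `(y, k)` (junk outside the range). [folklore] -/
noncomputable def decode [Inhabited Γ] (v : ℕ) : Γ × Fin 8 :=
  if h : v / 8 < Fintype.card Γ then (idx.symm ⟨v / 8, h⟩, ⟨v % 8, Nat.mod_lt v (by norm_num)⟩)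
  else (default, 0)

/-- `decode` inverts the numbering. [folklore] -/
theorem decode_varNat [Inhabited Γ] (y : Γ) (k : Fin 8) : decode (varNat y k) = (y, k) := by
  have hk := k.isLt
  have h1 : varNat y k / 8 = (idx y : ℕ) := by unfold varNat; omega
  have h2 : varNat y k % 8 = (k : ℕ) := by unfold varNat; omega
  unfold decode
  rw [dif_pos (by rw [h1]; exact (idx y).isLt)]
  refine Prod.ext ?_ (Fin.ext h2)
  simp only
  rw [Equiv.symm_apply_eq]
  exact Fin.ext h1

variable [Group Γ] (g : Letter → Γ)

/-- The support of the equation at `x`, as natural numbers: the variables of the edges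
`{x, g_k x}` (numbered at `x`) and `{g_k⁻¹ x, x}` (numbered at `g_k⁻¹ x`). [folklore] -/
noncomputable def scopeNat (x : Γ) : Finset ℕ :=
  (univ : Finset (Fin 8)).image (fun k => varNat x k) ∪
    (univ : Finset (Fin 8)).image (fun k => varNat ((g (k, true))⁻¹ * x) k)

/-- Membership in `scopeNat`. [folklore] -/
theorem mem_scopeNat {x : Γ} {v : ℕ} :
    v ∈ scopeNat g x ↔ (∃ k, varNat x k = v) ∨ ∃ k, varNat ((g (k, true))⁻¹ * x) k = v := by
  simp [scopeNat]

/-- Every element of a scope is an edge-variable number, `< 8|Γ|`. [folklore] -/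
theorem lt_of_mem_scopeNat {x : Γ} {v : ℕ} (hv : v ∈ scopeNat g x) : v < 8 * Fintype.card Γ := by
  rcases (mem_scopeNat g).1 hv with ⟨k, rfl⟩ | ⟨k, rfl⟩ <;> exact varNat_lt _ _

/-- A scope has at most `16` elements. [folklore] -/
theorem card_scopeNat_le (x : Γ) : (scopeNat g x).card ≤ 16 := by
  unfold scopeNat
  refine (card_union_le _ _).trans ?_
  have h1 : ((univ : Finset (Fin 8)).image fun k => varNat x k).card ≤ 8 :=
    card_image_le.trans (by simp)
  have h2 : ((univ : Finset (Fin 8)).image fun k => varNat ((g (k, true))⁻¹ * x) k).card ≤ 8 :=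
    card_image_le.trans (by simp)
  omega

/-- **The rows through an edge variable.** The variable `x(y, k)` lies in the scopes of exactly
the rows `y` and `g_k y`. [folklore] -/
theorem varNat_mem_scopeNat_iff {y x : Γ} {k : Fin 8} :
    varNat y k ∈ scopeNat g x ↔ x = y ∨ x = g (k, true) * y := by
  rw [mem_scopeNat]
  constructor
  · rintro (⟨k', h⟩ | ⟨k', h⟩)
    · exact Or.inl (varNat_inj h).1
    · obtain ⟨h1, rfl⟩ := varNat_inj h
      right
      rw [← h1]; group
  · rintro (rfl | rfl)
    · exact Or.inl ⟨k, rfl⟩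
    · exact Or.inr ⟨k, by group⟩

/-- If no marked element is trivial, a scope has exactly `16` elements. [folklore] -/
theorem card_scopeNat (hg1 : ∀ σ, g σ ≠ 1) (x : Γ) : (scopeNat g x).card = 16 := by
  unfold scopeNat
  rw [card_union_of_disjoint, card_image_of_injective, card_image_of_injective]
  · simp
  · intro k k' h; exact (varNat_inj h).2
  · intro k k' h; exact (varNat_inj h).2
  · rw [Finset.disjoint_left]
    intro v hv hv'
    simp only [mem_image, mem_univ, true_and] at hv hv'
    obtain ⟨k, rfl⟩ := hv
    obtain ⟨k', h⟩ := hv'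
    obtain ⟨h1, rfl⟩ := varNat_inj h
    exact hg1 (k', true) (by simpa using congrArg (· * x⁻¹) h1)

/-! ### The system -/

variable [DecidableEq Γ] {n : ℕ}

/-- **The Tseitin system of the left Cayley graph** on `n ≥ 8|Γ|` variables over `𝔽₂`: the
equation of `x ∈ Γ` has coefficient `1` exactly on `scopeNat g x` and right-hand side `[x = 1]`.
[cite: Margulis1982, main construction] -/
noncomputable def tseitin (n : ℕ) : Fin (Fintype.card Γ) → LinEqMod 2 n :=
  fun i => (fun j => if (j : ℕ) ∈ scopeNat g (idx.symm i) then 1 else 0,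
    if idx.symm i = 1 then 1 else 0)

/-- The coefficients of a Tseitin equation. [folklore] -/
theorem tseitin_fst_apply (i : Fin (Fintype.card Γ)) (j : Fin n) :
    (tseitin g n i).1 j = if (j : ℕ) ∈ scopeNat g (idx.symm i) then 1 else 0 := by
  simp only [tseitin]

/-- The right-hand side of a Tseitin equation. [folklore] -/
theorem tseitin_snd (i : Fin (Fintype.card Γ)) :
    (tseitin g n i).2 = if idx.symm i = 1 then 1 else 0 := by
  simp only [tseitin]

/-- Membership in the support of a Tseitin equation. [folklore] -/
theorem mem_supp_tseitin {i : Fin (Fintype.card Γ)} {j : Fin n} :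
    j ∈ (tseitin g n i).supp ↔ (j : ℕ) ∈ scopeNat g (idx.symm i) := by
  rw [LinEqMod.supp, Finset.mem_filter, tseitin_fst_apply]
  simp only [mem_univ, true_and, ne_eq, ite_eq_right_iff, one_ne_zero, imp_false, not_not]

/-- The support of a Tseitin equation, read in `ℕ`, is its scope (when `n ≥ 8|Γ|`). [folklore] -/
theorem map_supp_tseitin (hn : 8 * Fintype.card Γ ≤ n) (i : Fin (Fintype.card Γ)) :
    (tseitin g n i).supp.map Fin.valEmbedding = scopeNat g (idx.symm i) := by
  ext v
  rw [Finset.mem_map]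
  constructor
  · rintro ⟨j, hj, rfl⟩
    exact (mem_supp_tseitin g).1 hj
  · intro hv
    exact ⟨⟨v, (lt_of_mem_scopeNat g hv).trans_le hn⟩, (mem_supp_tseitin g).2 hv, rfl⟩

/-- **`16`-sparsity.** Every Tseitin equation has at most `16` variables. [folklore] -/
theorem card_supp_tseitin_le (hn : 8 * Fintype.card Γ ≤ n) (i : Fin (Fintype.card Γ)) :
    (tseitin g n i).supp.card ≤ 16 := by
  rw [← Finset.card_map Fin.valEmbedding, map_supp_tseitin g hn]
  exact card_scopeNat_le g _

/-- The rows whose scope contains `v` (as a set of group elements) are either none or the two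
endpoints `{y, g_k y}` of the edge `v = x(y, k)`. [folklore] -/
theorem card_rows_eq (hg1 : ∀ σ, g σ ≠ 1) (v : ℕ) :
    (univ.filter fun x : Γ => v ∈ scopeNat g x).card = 0 ∨
      (univ.filter fun x : Γ => v ∈ scopeNat g x).card = 2 := by
  by_cases h : ∃ (y : Γ) (k : Fin 8), varNat y k = v
  · obtain ⟨y, k, rfl⟩ := h
    right
    have : (univ.filter fun x : Γ => varNat y k ∈ scopeNat g x) = {y, g (k, true) * y} := by
      ext x
      simp [varNat_mem_scopeNat_iff]
    rw [this, card_pair]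
    intro hy
    exact hg1 (k, true) (by simpa using congrArg (· * y⁻¹) hy.symm)
  · left
    rw [Finset.card_eq_zero, Finset.filter_eq_empty_iff]
    intro x _ hv
    rcases (mem_scopeNat g).1 hv with ⟨k, hk⟩ | ⟨k, hk⟩
    · exact h ⟨x, k, hk⟩
    · exact h ⟨_, k, hk⟩

/-- **Column sums vanish.** Over `𝔽₂`, the coefficients of any fixed variable over all Tseitin
equations sum to `0` (the variable lies in `0` or `2` equations). [folklore] -/
theorem sum_coeff_tseitin (hg1 : ∀ σ, g σ ≠ 1) (j : Fin n) : ∑ i, (tseitin g n i).1 j = 0 := by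
  simp_rw [tseitin_fst_apply]
  rw [Finset.sum_boole]
  have hcard :
      (univ.filter fun i : Fin (Fintype.card Γ) => (j : ℕ) ∈ scopeNat g (idx.symm i)).card =
      (univ.filter fun x : Γ => (j : ℕ) ∈ scopeNat g x).card := by
    refine Finset.card_bij (fun i _ => idx.symm i) (fun i hi => ?_) (fun i _ i' _ h => ?_)
      (fun x hx => ⟨idx x, ?_, ?_⟩)
    · simpa using hi
    · exact idx.symm.injective h
    · simpa using hx
    · simp
  rw [hcard]
  rcases card_rows_eq g hg1 (j : ℕ) with h | h <;> rw [h] <;> decide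

/-- **The Tseitin system of a Cayley graph is unsolvable**: summing all equations gives
`0 = 1` (total charge `1`, at the identity). [folklore] -/
theorem not_systemSat_tseitin (hg1 : ∀ σ, g σ ≠ 1) : ¬ SystemSat (tseitin g n) Finset.univ := by
  rintro ⟨z, hz⟩
  have hsum : ∑ i, ∑ j, (tseitin g n i).1 j * z j = ∑ i, (tseitin g n i).2 :=
    Finset.sum_congr rfl fun i _ => hz i (mem_univ i)
  have hlhs : ∑ i, ∑ j, (tseitin g n i).1 j * z j = 0 := by
    rw [Finset.sum_comm]
    refine Finset.sum_eq_zero fun j _ => ?_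
    rw [← Finset.sum_mul, sum_coeff_tseitin g hg1 j, zero_mul]
  have hrhs : ∑ i, (tseitin g n i).2 = 1 := by
    simp_rw [tseitin_snd]
    have : ∀ i : Fin (Fintype.card Γ), (idx.symm i = (1 : Γ)) ↔ i = idx 1 := fun i =>
      Equiv.symm_apply_eq idx
    simp_rw [this]
    rw [Finset.sum_ite_eq']
    simp
  rw [hlhs, hrhs] at hsum
  exact zero_ne_one hsum

/-! ### Boundary expansion -/

/-- **The boundary count.** If the marked elements satisfy no reduced relation of length `≤ 2R`
(`R ≥ 1`) and `n ≥ 8|Γ|`, every set `F` of at most `2^R` Tseitin equations has at least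
`12|F|` unique-neighbour variables. [cite: Margulis1982, main construction] -/
theorem boundary_tseitin_ge (hg : ∀ σ, g σ.bar = (g σ)⁻¹) {R : ℕ} (hR : 1 ≤ R)
    (hL : NoShortRelations g (2 * R)) (hn : 8 * Fintype.card Γ ≤ n)
    (F : Finset (Fin (Fintype.card Γ))) (hF : F.card ≤ 2 ^ R) :
    12 * F.card ≤ (boundary (fun i => (tseitin g n i).supp.map Fin.valEmbedding) F).card := by
  classical
  haveI : Inhabited Γ := ⟨1⟩
  have hg1 : ∀ σ, g σ ≠ 1 := hL.g_ne_one (by omega)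
  set S : Fin (Fintype.card Γ) → Finset ℕ := fun i => (tseitin g n i).supp.map Fin.valEmbedding
    with hSdef
  have hS : ∀ i, S i = scopeNat g (idx.symm i) := fun i => map_supp_tseitin g hn i
  -- the rows of `F` as group elements
  set F' : Finset Γ := F.map idx.symm.toEmbedding with hF'def
  have hF'card : F'.card = F.card := Finset.card_map _
  have hsparse : edgeCount g F' ≤ 2 * F.card := by
    rw [← hF'card]; exact edgeCount_le_two_mul_card hg hR hL F' (by rw [hF'card]; exact hF)
  -- total incidences
  have htot : ∑ v ∈ cover S F, coverDegree S F v = 16 * F.card := by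
    rw [sum_coverDegree, Finset.sum_congr rfl fun i _ => by rw [hS, card_scopeNat g hg1],
      Finset.sum_const, smul_eq_mul, mul_comm]
  -- every cover degree is at most `2`
  have hdeg2 : ∀ v, coverDegree S F v ≤ 2 := by
    intro v
    unfold coverDegree
    calc (F.filter fun i => v ∈ S i).card
        ≤ (univ.filter fun i : Fin (Fintype.card Γ) => v ∈ S i).card :=
          Finset.card_le_card (Finset.filter_subset_filter _ (Finset.subset_univ F))
      _ = (univ.filter fun x : Γ => v ∈ scopeNat g x).card := by
          refine Finset.card_bij (fun i _ => idx.symm i) (fun i hi => ?_) (fun i _ i' _ h => ?_)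
            (fun x hx => ⟨idx x, ?_, ?_⟩)
          · simpa [hS] using hi
          · exact idx.symm.injective h
          · simpa [hS] using hx
          · simp
      _ ≤ 2 := by rcases card_rows_eq g hg1 v with h | h <;> omega
  -- split the incidence sum over boundary / doubly covered points
  have hsplit : ∑ v ∈ cover S F, coverDegree S F v = (boundary S F).card +
      ∑ v ∈ (cover S F).filter (fun v => ¬ coverDegree S F v = 1), coverDegree S F v := by
    rw [← Finset.sum_filter_add_sum_filter_not (cover S F) (fun v => coverDegree S F v = 1)]
    congr 1
    rw [Finset.card_eq_sum_ones, boundary]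
    exact Finset.sum_congr rfl fun v hv => (Finset.mem_filter.1 hv).2
  set D := (cover S F).filter fun v => ¬ coverDegree S F v = 1 with hDdef
  have hDsum : ∑ v ∈ D, coverDegree S F v ≤ 2 * D.card := by
    have h2 : ∑ v ∈ D, coverDegree S F v ≤ ∑ v ∈ D, 2 := Finset.sum_le_sum fun v _ => hdeg2 v
    rw [Finset.sum_const, smul_eq_mul] at h2
    omega
  -- the doubly covered points inject into the Cayley edges spanned by `F'`
  have hDedges : D.card ≤ edgeCount g F' := by
    refine Finset.card_le_card_of_injOn decode (fun v hv => ?_) ?_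
    · -- a doubly covered `v` is `x(y,k)` with both `y` and `g_k y` rows of `F`
      simp only [hDdef, Finset.coe_filter, Set.mem_setOf_eq] at hv
      obtain ⟨hvcov, hvdeg⟩ := hv
      have hdv : coverDegree S F v = 2 := by
        have h1 := one_le_coverDegree (S := S) hvcov
        have h2 := hdeg2 v
        omega
      -- two distinct rows of `F` through `v`
      unfold coverDegree at hdv
      obtain ⟨i₁, i₂, hne, hpair⟩ := Finset.card_eq_two.1 hdv
      have hi₁ : i₁ ∈ F.filter fun i => v ∈ S i := by rw [hpair]; simp
      have hi₂ : i₂ ∈ F.filter fun i => v ∈ S i := by rw [hpair]; simp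
      rw [Finset.mem_filter, hS] at hi₁ hi₂
      -- `v` is an edge variable
      obtain ⟨y, k, rfl⟩ : ∃ (y : Γ) (k : Fin 8), varNat y k = v := by
        rcases (mem_scopeNat g).1 hi₁.2 with ⟨k, hk⟩ | ⟨k, hk⟩
        · exact ⟨_, k, hk⟩
        · exact ⟨_, k, hk⟩
      rw [varNat_mem_scopeNat_iff] at hi₁ hi₂
      simp only [Finset.coe_filter, Set.mem_setOf_eq, decode_varNat]
      -- both endpoints are rows of `F`
      have hy : y ∈ F' ∧ g (k, true) * y ∈ F' := by
        have key : ∀ i, i ∈ F → (idx.symm i = y ∨ idx.symm i = g (k, true) * y) →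
            idx.symm i ∈ F' := fun i hi _ => by
          rw [hF'def, Finset.mem_map_equiv]; simpa using hi
        rcases hi₁ with ⟨h1F, h1 | h1⟩ <;> rcases hi₂ with ⟨h2F, h2 | h2⟩
        · exact absurd (idx.symm.injective (h1.trans h2.symm)) hne
        · exact ⟨h1 ▸ key i₁ h1F (Or.inl h1), h2 ▸ key i₂ h2F (Or.inr h2)⟩
        · exact ⟨h2 ▸ key i₂ h2F (Or.inl h2), h1 ▸ key i₁ h1F (Or.inr h1)⟩
        · exact absurd (idx.symm.injective (h1.trans h2.symm)) hne
      exact ⟨Finset.mem_product.2 ⟨hy.1, mem_univ _⟩, hy.2⟩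
    · intro v hv v' hv' h
      simp only [hDdef, Finset.coe_filter, Set.mem_setOf_eq] at hv hv'
      obtain ⟨i, -, hvi⟩ := mem_cover.1 hv.1
      obtain ⟨i', -, hvi'⟩ := mem_cover.1 hv'.1
      rw [hS] at hvi hvi'
      obtain ⟨y, k, rfl⟩ : ∃ (y : Γ) (k : Fin 8), varNat y k = v := by
        rcases (mem_scopeNat g).1 hvi with ⟨k, hk⟩ | ⟨k, hk⟩
        · exact ⟨_, k, hk⟩
        · exact ⟨_, k, hk⟩
      obtain ⟨y', k', rfl⟩ : ∃ (y : Γ) (k : Fin 8), varNat y k = v' := by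
        rcases (mem_scopeNat g).1 hvi' with ⟨k, hk⟩ | ⟨k, hk⟩
        · exact ⟨_, k, hk⟩
        · exact ⟨_, k, hk⟩
      rw [decode_varNat, decode_varNat] at h
      obtain ⟨rfl, rfl⟩ := Prod.mk.inj h
      rfl
  omega

/-- **Boundary expansion of the Tseitin system.** Under the same hypotheses, for every real
`r ≤ 2^R` the supports of the Tseitin equations form an `(r, 12)`-boundary expander
(`12 = 3/4 · 16`). [cite: Margulis1982, main construction] -/
theorem isBoundaryExpander_tseitin (hg : ∀ σ, g σ.bar = (g σ)⁻¹) {R : ℕ} (hR : 1 ≤ R)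
    (hL : NoShortRelations g (2 * R)) (hn : 8 * Fintype.card Γ ≤ n) {r : ℝ} (hr : r ≤ 2 ^ R) :
    IsBoundaryExpander (fun i => (tseitin g n i).supp.map Fin.valEmbedding) r 12 := by
  intro F hF
  have hFn : F.card ≤ 2 ^ R := by exact_mod_cast hF.trans hr
  exact_mod_cast boundary_tseitin_ge g hg hR hL hn F hFn

end FreeCayley

end Summit.PneNP.PneNP.Theorems
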